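import Literature.AnabelianGeometry.EtaleTheta.Discharge.Sec2RigidityProofs

/-!
# [EtTh] Prop 2.12 (i), (ii) REDUCED to the commutator description of `l·Δ_Θ` (proof-only companion)

Mochizuki, *The Étale Theta Function …* [EtTh], Publ. RIMS 45 (2009), §2, Prop 2.12, PRIMS PDF p.45
(locators `p.N` = PDF pages; bib key `MochizukiEtTh2009`): "(i) We have an inclusion
`Ker(Δ^Θ_* ↠ Δ^ell_*) = l·Δ_Θ ⊆ [Δ^Θ_*, Δ^Θ_*]` … as follows immediately from the well-known structure of
the theta-group `(l·Δ_Θ ⊆) Δ^Θ_*`"; "(ii) follows formally from (i)".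

PROOF-ONLY companion of `ThetaRigidity.lean` (seat abc-iut-L2-t2), seat abc-iut-L2-t10 (unit
"deep EtTh:Prop2.14(ii)-model (hgal)", side result). The named facts `RigidData.Prop212_i` /
`Prop212_ii` are DERIVED from the `⊆` half of the commutator description of `l·Δ_Θ` used in
`Discharge/Sec2SymmetryProofs.lean` (`hcomm`): every element of (the inverse image in `Π^tp_X` of) `l·Δ_Θ`
is a single commutator `[z, b]` of `z ∈ Δ^tp_X`, `b ∈ Δ^tp_Y`, times an element of
`Ker(Π^tp_X ↠ (Π^tp_X)^Θ)` — "the well-known structure of the theta-group", the target of the cell's unit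
N8 (Heisenberg structure of the tempered theta quotient, for abc-iut-L2-t8's model). So, once N8 lands
for a `RigidData`, Prop 2.12 (i) and (ii) follow for it by `prop212_i_of_commutator_subset` /
`prop212_ii_of_commutator_subset`. HONEST FRAMING: a reduction, kernel-checked; the hypothesis is not
asserted; no side taken on [IUTchIII] Cor 3.12.
-/

namespace Literature.AnabelianGeometry.EtaleTheta

open scoped commutatorElement

universe u

namespace RigidData

variable {N : ℕ+} {l : ℕ} (R : RigidData.{u} N l)

/-- **Prop 2.12 (i) ⟸ the `⊆` half of the commutator description of `l·Δ_Θ`** ("the well-known structure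
of the theta-group", p.45): if every element of `l·Δ_Θ` (pulled back to `Π^tp_X`) is `[z, b] · k` with
`z ∈ Δ^tp_X`, `b ∈ Δ^tp_Y`, `k ∈ Ker(Π^tp_X ↠ (Π^tp_X)^Θ)`, then `l·Δ_Θ ⊆ [Δ_X, Δ_X] · Ker`.
[cite: MochizukiEtTh2009, Prop 2.12(i) p.45] -/
theorem prop212_i_of_commutator_subset
    (h : ∀ t : R.PiX, t ∈ R.lDeltaTheta → ∃ z ∈ R.aug.ker, ∃ b ∈ R.PiY ⊓ R.aug.ker, ∃ k ∈ R.thetaKer,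
      t = z * b * z⁻¹ * b⁻¹ * k) :
    R.Prop212_i := by
  intro t ht
  obtain ⟨z, hz, b, hb, k, hk, rfl⟩ := h t ht
  refine Subgroup.mul_mem_sup ?_ hk
  have hzb : ⁅z, b⁆ ∈ ⁅R.aug.ker, R.aug.ker⁆ :=
    Subgroup.commutator_mem_commutator hz (Subgroup.mem_inf.1 hb).2
  rwa [commutatorElement_def] at hzb

/-- **Prop 2.12 (ii) ⟸ the same hypothesis** ("assertion (ii) follows formally from assertion (i)",
p.46; via `prop212_ii_of_prop212_i`). [cite: MochizukiEtTh2009, Prop 2.12(ii) p.45] -/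
theorem prop212_ii_of_commutator_subset
    (h : ∀ t : R.PiX, t ∈ R.lDeltaTheta → ∃ z ∈ R.aug.ker, ∃ b ∈ R.PiY ⊓ R.aug.ker, ∃ k ∈ R.thetaKer,
      t = z * b * z⁻¹ * b⁻¹ * k) :
    R.Prop212_ii :=
  R.prop212_ii_of_prop212_i (R.prop212_i_of_commutator_subset h)

/-- The hypothesis of `prop212_i_of_commutator_subset` is exactly the `→` direction of the `hcomm`
hypothesis of `RigidData.prop214_i_of_commutators` (`Discharge/Sec2SymmetryProofs.lean`), recorded as a
restatement-free implication for consumers holding `hcomm`. [cite: MochizukiEtTh2009, Prop 2.12(i) p.45] -/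
theorem prop212_i_of_hcomm
    (hcomm : ∀ t : R.PiX, t ∈ R.lDeltaTheta ↔ ∃ z ∈ R.aug.ker, ∃ b ∈ R.PiY ⊓ R.aug.ker, ∃ k ∈ R.thetaKer,
      t = z * b * z⁻¹ * b⁻¹ * k) :
    R.Prop212_i :=
  R.prop212_i_of_commutator_subset fun t ht => (hcomm t).1 ht

end RigidData

end Literature.AnabelianGeometry.EtaleTheta
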